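import Literature.Computability.Cryptography.LWEPrimePowerLevelSelect
import Literature.Computability.Cryptography.LWEPrimePowerDigitTest
import Literature.Computability.Cryptography.LWEPrimePowerTopDigits
import HarnessLib

/-!
# The Micciancio–Peikert search-to-decision reduction as one law, and its failure probability (MP12, Thm. 3.1)

Topic `Computability/Cryptography` (LWE), grouping namespace `LWE.MP12`; assembly of
`LWEPrimePowerLevelSelect.lean` (measure the levels, `selectStep`), `LWEPrimePowerDigitTest.lean` (the
digit loops `loopLaw (stepLaw …)` at the selected step) and `LWEPrimePowerTopDigits.lean` (round the raw
samples and solve, `recoverTop`). Proved material (no named fact) towards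
`Literature.Computability.Cryptography.blprs_gapSVP_sqrt_dim_to_lwe_classical` (**pqc.S21**), component
Thm. 2.17 = Micciancio–Peikert 2012, Thm. 3.1 (hypothesis `h₂` of `BLPRSReduction.…_of_components`;
ePrint 2011/501, pp. 15–16, the whole proof).

The reduction, with its three phases drawing FRESH data (this file is the idealised, phase-level law;
the per-input-tuple solver slicing one tuple of samples into these phases, and the machine, are the
sequels):

1. measure the `e + 1` levels of the aggregated-noise hybrids (`estLaw Dk χK gen e N'`) and select the
   step `i⋆ = selectStep e N' a`;
2. for every coordinate `c < d` independently, run the digit loop at step `i⋆` for `e - i⋆` rounds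
   (`loopLaw (stepLaw Dk χK N T γ i⋆ c s) (e - i⋆)`), keeping the state modulo `pᵉ` (`digitsLaw`);
3. round `m'` fresh RAW samples (noise `χ₁`) against the learned low digits and solve
   (`recoverTop (e - i⋆) (F (e - i⋆))`).

* `digitsLaw`, **`idealLaw`** — the composite law of the output, for the secret `s`.
* **`idealLaw_ne_le`** — the failure bound, for EVERY secret `s`:
  `Pr[output ≠ s] ≤ (e+1)/(4N'η²) + d·e·(δ₀ + (p-1)δ₁) + ρ`, with `η = Adv/(8e)`, `γ = Adv/(4e)`,
  `δ₀ = ((1-γ) + 8/(Nγ²))ᵀ`, `δ₁ = T·8/(Nγ²)`, `Adv` the average-case advantage of the distinguisher `Dk`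
  against the aggregated noise `χK`, and `ρ` any bound on the rounding failure valid at every step `i`
  that is NOT "close" (an upward-closed predicate `Close` whose levels have all hybrids `δc`-close to
  uniform in acceptance probability, `2δc < Adv/(2e)`; the sequel instantiates `Close i` as
  `pⁱ·rate₂ ≥ η_ε(ℤ)` by `LWEPrimePowerSmoothing.lean`). The proof conditions the first phase on the good
  measurement (`EstGood`, outside which `prob_not_estGood_le`), derives on it `|stepGap i⋆| ≥ Adv/(2e)`
  (`abs_stepGap_selectStep_ge` with `exists_abs_stepGap_ge`), hence the worst-case test's hypothesis
  (`gapHyp_of_abs_stepGap_ge`) and `¬ Close i⋆` (`not_close_of_abs_stepGap_gt`); the second phase on all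
  `d` loops returning the true low digits (`prob_digits_ne_lowPart_le`, union over the coordinates); and
  on both, the third phase returns `s` unless `¬ TopGood` (`recoverTop_eq_of_topGood`).

## References

* D. Micciancio, C. Peikert, *Trapdoors for lattices: simpler, tighter, faster, smaller*, EUROCRYPT 2012,
  LNCS 7237; full version IACR ePrint 2011/501, §3, Thm. 3.1 and its proof, pp. 15–16 (read:
  `lit read paper:doi-10-1007-978-3-642-29011-4-41`, p0015–p0016). [MicciancioPeikert2012]
* Z. Brakerski, A. Langlois, C. Peikert, O. Regev, D. Stehlé, *Classical hardness of learning with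
  errors*, STOC 2013 (arXiv:1306.0281), Thm. 2.17. [BrakerskiEtAl2013]
-/

noncomputable section

open scoped ENNReal

namespace Literature.Computability.Cryptography

namespace LWE

namespace MP12

open Literature.Probability.Distributions

/-! ### A conditioning lemma with a good set -/

section Helper

variable {α β : Type}

/-- **Conditioning a `bind` on a good set**: if from every point of `G` the second stage gives `E` mass
`≤ δ`, then `Pr[E] ≤ Pr[Gᶜ] + δ`. [folklore] -/
theorem toOuterMeasure_bind_le_compl_add (μ : PMF α) (f : α → PMF β) (E : Set β) (G : Set α) {δ : ℝ≥0∞}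
    (h : ∀ a ∈ G, (f a).toOuterMeasure E ≤ δ) : (μ.bind f).toOuterMeasure E ≤ μ.toOuterMeasure Gᶜ + δ := by
  classical
  rw [PMF.toOuterMeasure_bind_apply, PMF.toOuterMeasure_apply]
  have hpt : ∀ a, μ a * (f a).toOuterMeasure E ≤ Gᶜ.indicator μ a + μ a * δ := by
    intro a
    by_cases ha : a ∈ G
    · rw [Set.indicator_of_notMem (by simpa using ha), zero_add]
      gcongr
      exact h a ha
    · rw [Set.indicator_of_mem (by simpa using ha)]
      calc μ a * (f a).toOuterMeasure E ≤ μ a * 1 := by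
            gcongr
            exact ((f a).toOuterMeasure_mono (fun _ _ => Set.mem_univ _)).trans_eq
              (((f a).toOuterMeasure_apply_eq_one_iff Set.univ).2 (Set.subset_univ _))
        _ = μ a := mul_one _
        _ ≤ μ a + μ a * δ := le_self_add
  calc ∑' a, μ a * (f a).toOuterMeasure E ≤ ∑' a, (Gᶜ.indicator μ a + μ a * δ) := ENNReal.tsum_le_tsum hpt
    _ = ∑' a, Gᶜ.indicator μ a + ∑' a, μ a * δ := ENNReal.tsum_add
    _ = ∑' a, Gᶜ.indicator μ a + δ := by rw [ENNReal.tsum_mul_right, PMF.tsum_coe, one_mul]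

end Helper

/-! ### The idealised law of the reduction -/

section Ideal

variable {d : ℕ} {p : ℕ} [hp : Fact p.Prime] {e : ℕ} {m : ℕ}
variable (Dk : (Fin m → (Fin d → ZMod (p ^ e)) × ZMod (p ^ e)) → PMF Bool) (χK χ₁ : PMF (ZMod (p ^ e)))
variable (N T N' m' : ℕ) (γ : ℝ)
variable (F : ℕ → (Fin m' → (Fin d → ZMod (p ^ e)) × ZMod (p ^ e)) → (Fin m' → ZMod (p ^ e)) → (Fin d → ZMod (p ^ e)))

/-- **Phase 2**: the `d` digit loops at the step `i⋆` selected from the measurement `a`, independently,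
their final states read modulo `pᵉ`. [cite: MicciancioPeikert2012, Thm. 3.1 proof (p. 16: "all of what follows is analogous for `s₂, …, sₙ`")] -/
def digitsLaw (a : Fin (e + 1) → Fin N' → Bool) (s : Fin d → ZMod (p ^ e)) : PMF (Fin d → ZMod (p ^ e)) :=
  piLaw fun c : Fin d =>
    (loopLaw (stepLaw Dk χK N T γ (selectStep e N' a) c s) (e - selectStep e N' a)).map fun L : ℕ => (L : ZMod (p ^ e))

/-- **The idealised law of the reduction's output** for the secret `s`: measure and select the step
(phase 1), run the digit loops (phase 2), round `m'` fresh raw samples against the learned low digits and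
solve (phase 3). [cite: MicciancioPeikert2012, Thm. 3.1 proof (pp. 15–16)] -/
def idealLaw (s : Fin d → ZMod (p ^ e)) : PMF (Fin d → ZMod (p ^ e)) :=
  (estLaw Dk χK (gen p e) e N').bind fun a =>
    (digitsLaw Dk χK N T N' γ a s).bind fun Ls =>
      (lweSamples χ₁ s m').map fun S => recoverTop (e - selectStep e N' a) (F (e - selectStep e N' a)) S Ls

variable {Dk χK χ₁ N T N' m' γ F}

/-- The loops of phase 2 return the true low digits except with probability `≤ d·e·(δ₀ + (p-1)δ₁)`, at
any selected step `i⋆ < e` satisfying the worst-case test's hypothesis. [cite: MicciancioPeikert2012, Thm. 3.1 proof (p. 16)] -/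
theorem digitsLaw_ne_lowVec_le (he : 0 < e) (hN : 0 < N) (hγ : 0 < γ) (a : Fin (e + 1) → Fin N' → Bool)
    (hG : GapHyp Dk χK (gen p e (selectStep e N' a)) (gen p e (selectStep e N' a + 1)) γ)
    (s : Fin d → ZMod (p ^ e)) :
    (digitsLaw Dk χK N T N' γ a s).toOuterMeasure {Ls | Ls ≠ lowVec (e - selectStep e N' a) s} ≤
      d * (e * ((ENNReal.ofReal (1 - γ) + ENNReal.ofReal (8 / (N * γ ^ 2))) ^ T +
        (p - 1 : ℕ) * (T * ENNReal.ofReal (8 / (N * γ ^ 2))))) := by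
  set i₀ := selectStep e N' a with hi₀
  set X := (ENNReal.ofReal (1 - γ) + ENNReal.ofReal (8 / (N * γ ^ 2))) ^ T +
    (p - 1 : ℕ) * (T * ENNReal.ofReal (8 / (N * γ ^ 2))) with hX
  have hset : {Ls : Fin d → ZMod (p ^ e) | Ls ≠ lowVec (e - i₀) s} =
      {Ls | ∃ c, Ls c ∈ {x : ZMod (p ^ e) | x ≠ lowVec (e - i₀) s c}} := by
    ext Ls
    simp only [Set.mem_setOf_eq, ne_eq, funext_iff, not_forall]
  unfold digitsLaw
  rw [hset]
  refine (piLaw_toOuterMeasure_exists_mem_le _ _).trans ?_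
  have hc : ∀ c : Fin d, ((loopLaw (stepLaw Dk χK N T γ i₀ c s) (e - i₀)).map fun L : ℕ => (L : ZMod (p ^ e))).toOuterMeasure
      {x : ZMod (p ^ e) | x ≠ lowVec (e - i₀) s c} ≤ e * X := by
    intro c
    rw [PMF.toOuterMeasure_map_apply]
    calc (loopLaw (stepLaw Dk χK N T γ i₀ c s) (e - i₀)).toOuterMeasure
          ((fun L : ℕ => (L : ZMod (p ^ e))) ⁻¹' {x : ZMod (p ^ e) | x ≠ lowVec (e - i₀) s c})
        ≤ (loopLaw (stepLaw Dk χK N T γ i₀ c s) (e - i₀)).toOuterMeasure {L | L ≠ lowPart (s c) (e - i₀)} := by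
          refine MeasureTheory.measure_mono fun L hL => ?_
          simp only [Set.mem_preimage, Set.mem_setOf_eq, lowVec] at hL ⊢
          intro h
          exact hL (by rw [h])
      _ ≤ (e - i₀ : ℕ) * X := prob_digits_ne_lowPart_le he hN hγ hG s c (by
          have := selectStep_lt (e := e) (N' := N') he a; omega)
      _ ≤ e * X := by gcongr; exact_mod_cast Nat.sub_le e i₀
  calc ∑ c : Fin d, ((loopLaw (stepLaw Dk χK N T γ i₀ c s) (e - i₀)).map fun L : ℕ => (L : ZMod (p ^ e))).toOuterMeasure
          {x : ZMod (p ^ e) | x ≠ lowVec (e - i₀) s c}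
      ≤ ∑ _c : Fin d, e * X := Finset.sum_le_sum fun c _ => hc c
    _ = d * (e * X) := by rw [Finset.sum_const, Finset.card_univ, Fintype.card_fin, nsmul_eq_mul]

/-- **The failure probability of the idealised reduction** (every secret `s`; `1 ≤ e`; see the module
docstring for the constants): `Pr[output ≠ s] ≤ (e+1)/(4N'η²) + d·e·(δ₀ + (p-1)δ₁) + ρ`.
[cite: MicciancioPeikert2012, Thm. 3.1 proof (pp. 15–16)] -/
theorem idealLaw_ne_le (he : 0 < e) (hN : 0 < N) (hN' : 0 < N') (hF : ∀ a, IsTopSolver a (F a))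
    (s : Fin d → ZMod (p ^ e))
    -- the advantage and the derived accuracies
    {Adv : ℝ} (hAdv : 0 < Adv) (hAdvle : Adv ≤ distinguishingAdvantage χK m Dk)
    (hγ : γ = Adv / (4 * e))
    -- the "close to uniform" levels
    (Close : ℕ → Prop) (hmono : ∀ j, Close j → Close (j + 1)) {δc : ℝ}
    (hclose : ∀ j σ', Close j →
      |pacc Dk (hybridSamples χK σ' (gen p e j) m) - pacc Dk (uniformSamples (Fin d) (ZMod (p ^ e)) m)| ≤ δc)
    (hδc : 2 * δc < Adv / (2 * e))
    -- the rounding failure at every step that is not close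
    {ρ : ℝ≥0∞} (hround : ∀ i < e, ¬ Close i → (lweSamples χ₁ s m').toOuterMeasure {S | ¬ TopGood (e - i) he s S} ≤ ρ) :
    (idealLaw Dk χK χ₁ N T N' m' γ F s).toOuterMeasure {x | x ≠ s} ≤
      (e + 1 : ℕ) * ENNReal.ofReal (1 / (4 * N' * (Adv / (8 * e)) ^ 2)) +
        d * (e * ((ENNReal.ofReal (1 - γ) + ENNReal.ofReal (8 / (N * γ ^ 2))) ^ T +
          (p - 1 : ℕ) * (T * ENNReal.ofReal (8 / (N * γ ^ 2))))) + ρ := by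
  have he' : (0 : ℝ) < e := by exact_mod_cast he
  set η : ℝ := Adv / (8 * e) with hη
  have hη0 : 0 < η := by positivity
  have hγ0 : 0 < γ := by rw [hγ]; positivity
  -- from a good measurement, phases 2 and 3 fail with probability `≤ d·e·(δ₀ + (p-1)δ₁) + ρ`
  have hin : ∀ a ∈ {a | EstGood Dk χK (gen p e) e N' η a},
      ((digitsLaw Dk χK N T N' γ a s).bind fun Ls =>
          (lweSamples χ₁ s m').map fun S => recoverTop (e - selectStep e N' a) (F (e - selectStep e N' a)) S Ls).toOuterMeasure
        {x | x ≠ s} ≤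
      d * (e * ((ENNReal.ofReal (1 - γ) + ENNReal.ofReal (8 / (N * γ ^ 2))) ^ T +
          (p - 1 : ℕ) * (T * ENNReal.ofReal (8 / (N * γ ^ 2))))) + ρ := by
    intro a ha
    -- a good measurement: the selected step has a large gap
    set i₀ := selectStep e N' a with hi₀
    have hi₀e : i₀ < e := selectStep_lt e N' he a
    have hgap : Adv / e - 4 * η ≤ |stepGap Dk χK (gen p e) i₀| :=
      abs_stepGap_selectStep_ge he ha ((exists_abs_stepGap_ge he (gen_zero p e) (isUnit_gen_self p e)).imp
        fun i hi => ⟨hi.1, le_trans (div_le_div_of_nonneg_right hAdvle he'.le) hi.2⟩)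
    have hgap' : Adv / (2 * e) ≤ |stepGap Dk χK (gen p e) i₀| := by
      have : Adv / e - 4 * η = Adv / (2 * e) := by rw [hη]; field_simp; ring
      rwa [this] at hgap
    have hG : GapHyp Dk χK (gen p e i₀) (gen p e (i₀ + 1)) γ :=
      gapHyp_of_abs_stepGap_ge i₀ (by rw [hγ]; convert hgap' using 1; field_simp; ring)
    have hnc : ¬ Close i₀ := not_close_of_abs_stepGap_gt hmono hclose (lt_of_lt_of_le hδc hgap')
    -- phase 2 then phase 3
    refine (toOuterMeasure_bind_le_add_of_point _ _ (lowVec (e - i₀) s) _).trans (add_le_add ?_ ?_)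
    · exact digitsLaw_ne_lowVec_le he hN hγ0 a hG s
    · rw [PMF.toOuterMeasure_map_apply]
      refine le_trans (MeasureTheory.measure_mono fun S hS => ?_) (hround i₀ hi₀e hnc)
      intro hgood
      exact hS (recoverTop_eq_of_topGood (e - i₀) he (Nat.sub_le e i₀) (hF _) s hgood)
  have hest : (estLaw Dk χK (gen p e) e N').toOuterMeasure {a | EstGood Dk χK (gen p e) e N' η a}ᶜ ≤
      (e + 1 : ℕ) * ENNReal.ofReal (1 / (4 * N' * η ^ 2)) := by
    rw [Set.compl_setOf]
    exact prob_not_estGood_le hN' hη0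
  unfold idealLaw
  calc _ ≤ (estLaw Dk χK (gen p e) e N').toOuterMeasure {a | EstGood Dk χK (gen p e) e N' η a}ᶜ +
        (d * (e * ((ENNReal.ofReal (1 - γ) + ENNReal.ofReal (8 / (N * γ ^ 2))) ^ T +
          (p - 1 : ℕ) * (T * ENNReal.ofReal (8 / (N * γ ^ 2))))) + ρ) :=
        toOuterMeasure_bind_le_compl_add _ _ _ _ hin
    _ ≤ _ := by rw [add_assoc]; exact add_le_add hest le_rfl

end Ideal

end MP12

end LWE

end Literature.Computability.Cryptography

end
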